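import Literature.NumberTheory.LFunctions.MoebiusWalshTypeIIZero
import HarnessLib

/-!
# Bourgain 2013, §2: the type-II box estimate for the unshifted window (`K = 0`) in the
# three-savings form `2^{-cρ} + 2^{Cρ - ci} + 2^{Cρ - c|T ∩ [0,i)|}` — proved

Topic `Literature/NumberTheory/LFunctions`, proofs companion of `MoebiusWalshCircuits.lean`
(named fact `bourgain_liouville_walsh_uniform`: J. Bourgain, *Möbius–Walsh correlation bounds and
an estimate of Mauduit and Rivat*, J. Anal. Math. **119** (2013) 147–163 = arXiv:1109.2784
[Bourgain2013MoebiusWalsh], Theorem 1, remark on `λ`). Everything here is PROVED (theorems only; no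
definition, no named fact).

The tree's `MoebiusWalshTypeII.boxSum_sq_typeII_zero_le` (file `MoebiusWalshTypeIIZero.lean`)
states the `K = 0` half of the type-II estimate of §2 ((2.1)–(2.22)) SQUARED and with the core
count in the closed form of `typeII_core_zero` (a double sum over the lag `h < L = 2^ρ` and the
`2`-adic valuation `r`, with a `min` of the sup branch (Lemma 2) and the progression branch
(Lemma 4)). This file evaluates it into the shape consumed by the `λ`-synthesis
`LiouvilleWalsh.bourgain_liouville_walsh_uniform_of_typeII` (file `LiouvilleWalshAssembly.lean`):

* `boxSum_sq_le_clean_zero` — with carry slack `t = 2ρ + 3` (`q = i + 3ρ + 4`):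
  `boxSum² ≤ (2^i 2^j)² (8·2^{-ρ} + (1 + log 2^q) C_κ 2^{10ρ+15} (2^{-c₀ i} + 2^{-c₀ w}))`,
  `w = |T ∩ [0,q)|`, `c₀ = (1-2κ)c₂`, `C_κ = 4/(1-2^{-κ}) + 16b/(b-1) + 37`, `b = 2^{1-2κ}`
  (`κ = walshL1Exponent < 1/2`, `c₂ = walshSupExponent`): the geometric series in `r` are summed
  (`sum_range_pow_le_inv`, `sum_range_succ_pow_le`, `sum_half_pow_le`) after choosing the switch
  point `r₀ = i - s`, `s = min(i, ⌊c₂w⌋ + 1)` between the two branches of the `min` — Bourgain's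
  (2.20)/(2.21) — so that both `2^{-(1-2κ)s}` and `η² 2^s` are savings (`core_summand_le`);
* `typeII_clean_zero` — **the `K = 0` case of the per-box hypothesis `hII`**: there are `c > 0`,
  `C ≥ 1` with `∑_{a ∈ D_i} |∑_{b ∈ D_j} β(b) w_T(ab)| ≤ (i+j+2)^C 2^{i+j} (2^{-cρ} + 2^{Cρ-ci} + 2^{Cρ-c|T ∩ [0,i)|})`
  for all `T`, `i ≤ j`, `1 ≤ ρ ≤ j`, `|β| ≤ 1` (signs `ε_a` turn `∑_a |·|` into a box sum,
  `exists_sign_boxSum`; then the square root and `log 2^q ≤ (i+j+2) 2^{ρ+2}`, `C_κ ≤ 3^{C-1}`).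

The shifted windows `K ≥ i - ρ` ((2.23)–(2.27), Lemma 5) are the other half of `hII` and are
not treated here. Parallel evaluations of the same closed form in other normalisations exist in
the tree (`MoebiusWalshTypeIIZeroBound.lean`, `MoebiusWalshTypeIIZeroEval.lean`, landed
concurrently by other seats); nothing from them is restated here, and the present file is the one
in the exact shape of `hII`.

## References

* J. Bourgain, J. Anal. Math. 119 (2013) 147–163; arXiv:1109.2784, §2 (2.13)–(2.22), (2.28)–(2.29).
  [Bourgain2013MoebiusWalsh]
-/

noncomputable section
open Finset Real

namespace Literature.NumberTheory.LFunctions.LiouvilleWalsh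

open Literature.NumberTheory.LFunctions.MoebiusWalshVaughan (natWalsh dyBlock mem_dyBlock boxSum)
open Literature.NumberTheory.LFunctions.MoebiusWalsh (walshSupExponent walshL1Exponent
  walshSupExponent_pos walshL1Exponent_pos walshL1Exponent_lt_half)
open Literature.NumberTheory.LFunctions.MoebiusWalshTypeII (boxSum_sq_typeII_zero_le
  lt_of_mem_filter_window card_dyBlock)

/-! ### Geometric sums and small arithmetic facts -/

/-- `c₂ = log₂(27/16)/4 ≤ 1`. [folklore] -/
theorem walshSupExponent_le_one' : walshSupExponent ≤ 1 := by
  unfold walshSupExponent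
  have h : Real.logb 2 (27 / 16) ≤ Real.logb 2 2 :=
    Real.logb_le_logb_of_le one_lt_two (by norm_num) (by norm_num)
  rw [Real.logb_self_eq_one one_lt_two] at h
  linarith


/-- `∑_{r ≤ n} b^r ≤ bⁿ · b/(b-1)` for `b > 1`. [folklore] -/
theorem sum_range_succ_pow_le {b : ℝ} (hb : 1 < b) (n : ℕ) :
    ∑ r ∈ range (n + 1), b ^ r ≤ b ^ n * (b / (b - 1)) := by
  have hb1 : b - 1 ≠ 0 := by linarith
  have hb0 : 0 < b - 1 := by linarith
  rw [geom_sum_eq (by linarith : b ≠ 1), div_le_iff₀ hb0, pow_succ]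
  have : b ^ n * (b / (b - 1)) * (b - 1) = b ^ n * b := by field_simp
  rw [this]
  linarith [pow_pos (by linarith : (0 : ℝ) < b) n]

/-- A finite set of naturals all `≥ r₁` has `∑ (1/2)^r ≤ 2 (1/2)^{r₁}`. [folklore] -/
theorem sum_half_pow_le (S : Finset ℕ) (r₁ : ℕ) (hS : ∀ r ∈ S, r₁ ≤ r) :
    ∑ r ∈ S, (1 / 2 : ℝ) ^ r ≤ 2 * (1 / 2 : ℝ) ^ r₁ := by
  classical
  -- `S ⊆ [r₁, r₁ + m)` for `m = S.sup id + 1`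
  set m : ℕ := S.sup id + 1 with hm
  have hsub : S ⊆ Finset.Ico r₁ (r₁ + m) := by
    intro r hr
    rw [Finset.mem_Ico]
    refine ⟨hS r hr, ?_⟩
    have : r ≤ S.sup id := Finset.le_sup (f := id) hr
    omega
  calc ∑ r ∈ S, (1 / 2 : ℝ) ^ r ≤ ∑ r ∈ Finset.Ico r₁ (r₁ + m), (1 / 2 : ℝ) ^ r :=
        Finset.sum_le_sum_of_subset_of_nonneg hsub fun r _ _ => by positivity
    _ = ∑ k ∈ range m, (1 / 2 : ℝ) ^ (r₁ + k) := by
        rw [Finset.sum_Ico_eq_sum_range]; simp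
    _ = (1 / 2 : ℝ) ^ r₁ * ∑ k ∈ range m, (1 / 2 : ℝ) ^ k := by
        rw [Finset.mul_sum]
        refine Finset.sum_congr rfl fun k _ => ?_
        rw [pow_add]
    _ ≤ (1 / 2 : ℝ) ^ r₁ * 2 := by
        refine mul_le_mul_of_nonneg_left ?_ (by positivity)
        have h := geom_sum_eq (show (1 / 2 : ℝ) ≠ 1 by norm_num) m
        rw [h]
        have : (0 : ℝ) < (1 / 2 : ℝ) ^ m := by positivity
        have e : (((1 / 2 : ℝ)) ^ m - 1) / (1 / 2 - 1) = 2 - 2 * (1 / 2 : ℝ) ^ m := by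
          field_simp; ring
        rw [e]; linarith
    _ = 2 * (1 / 2 : ℝ) ^ r₁ := mul_comm _ _

/-- For `1 ≤ h < 2^ρ`, `v₂(h) < ρ`. [folklore] -/
theorem factorization_two_lt_of_mem_Ico {ρ h : ℕ} (hh : h ∈ Finset.Ico 1 (2 ^ ρ)) :
    h.factorization 2 < ρ := by
  rw [Finset.mem_Ico] at hh
  have h0 : h ≠ 0 := by omega
  have h1 : 2 ^ h.factorization 2 ≤ h := Nat.ordProj_le 2 h0
  exact (Nat.pow_lt_pow_iff_right (by norm_num)).1 (lt_of_le_of_lt h1 hh.2)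

/-- **Signs**: `∑_a |F a| = ∑_a ε_a F a` with `ε_a ∈ {±1}`. [folklore] -/
theorem exists_sign_sum_abs_eq (s : Finset ℕ) (F : ℕ → ℝ) :
    ∃ ε : ℕ → ℝ, (∀ a, |ε a| ≤ 1) ∧ ∑ a ∈ s, |F a| = ∑ a ∈ s, ε a * F a := by
  refine ⟨fun a => if 0 ≤ F a then 1 else -1, fun a => ?_, ?_⟩
  · dsimp only
    split_ifs <;> simp
  · refine Finset.sum_congr rfl fun a _ => ?_
    dsimp only
    split_ifs with h
    · rw [abs_of_nonneg h, one_mul]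
    · rw [abs_of_neg (lt_of_not_ge h)]; ring

/-- `∑_a |∑_b β_b w_T(ab)| = boxSum T i j ε β` for suitable signs `ε`. [folklore] -/
theorem exists_sign_boxSum (T : Finset ℕ) (i j : ℕ) (β : ℕ → ℝ) :
    ∃ ε : ℕ → ℝ, (∀ a, |ε a| ≤ 1) ∧
      ∑ a ∈ dyBlock i, |∑ b ∈ dyBlock j, β b * natWalsh T (a * b)| = boxSum T i j ε β := by
  obtain ⟨ε, hε, h⟩ := exists_sign_sum_abs_eq (dyBlock i)
    (fun a => ∑ b ∈ dyBlock j, β b * natWalsh T (a * b))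
  refine ⟨ε, hε, ?_⟩
  rw [h]
  unfold boxSum
  refine Finset.sum_congr rfl fun a _ => ?_
  rw [Finset.mul_sum]
  refine Finset.sum_congr rfl fun b _ => ?_
  ring

/-- `∑_{r<n} x^r ≤ 1/(1-x)` for `0 ≤ x < 1`. [folklore] -/
theorem sum_range_pow_le_inv {x : ℝ} (hx0 : 0 ≤ x) (hx1 : x < 1) (n : ℕ) :
    ∑ r ∈ range n, x ^ r ≤ 1 / (1 - x) := by
  rw [le_div_iff₀ (by linarith), geom_sum_mul_neg]
  have : 0 ≤ x ^ n := pow_nonneg hx0 n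
  linarith

/-! ### The `K = 0` type-II box estimate in clean form -/

/-- **One summand of the core count** (`h` fixed with `v = v₂(h) < ρ`, `r < q = i + 3ρ + 4`):
the factor `N + 2^{q-r}` is `≤ N 2^{3ρ+5}`, the flat term is `4·lg·2^{κq}·2^{κq}(2^{-κ})^r`, and the
resonant term is at most `4·lg·2^r B₀(r)` with `B₀` the progression branch `4·2^{κρ}2^{2κ(q-r)}` for
`r + s ≤ i` and the sup branch `η² 2^ρ 2^{2(q-r)}` otherwise, written in closed-exponent form.
[cite: Bourgain2013MoebiusWalsh, §2 (2.15)–(2.22)] -/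
theorem core_summand_le {i j ρ q r v s : ℕ} {κ η lg : ℝ} (hκ0 : 0 < κ) (hlg1 : 1 ≤ lg)
    (hqi : q = i + 3 * ρ + 4) (hij : i ≤ j) (hr : r < q) (hv : v < ρ)
    (hlog : 1 + Real.log ((2 : ℝ) ^ (r - v)) ≤ lg) :
    ((2 : ℝ) ^ j + 2 ^ (q - r)) *
        (lg * (2 * (2 : ℝ) ^ (κ * q) * (2 * (2 : ℝ) ^ (κ * ((q - r : ℕ) : ℝ)))) +
          2 * (min (η ^ 2 * 2 ^ (q - (r - v)) * 2 ^ (q - r))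
              (2 * (2 : ℝ) ^ (κ * ((q - (r - v) : ℕ) : ℝ)) * (2 * (2 : ℝ) ^ (κ * ((q - r : ℕ) : ℝ)))) *
            (2 * ((2 : ℝ) ^ i / 2 ^ (q - r)) + 2 ^ (r - v) * (1 + Real.log ((2 : ℝ) ^ (r - v)))))) ≤
      (2 : ℝ) ^ j * 2 ^ (3 * ρ + 5) * lg *
        (4 * (2 : ℝ) ^ (κ * q) * ((2 : ℝ) ^ (κ * q) * ((2 : ℝ) ^ (-κ)) ^ r) +
          4 * (if r + s ≤ i then 4 * (2 : ℝ) ^ (κ * ρ + 2 * κ * q) * ((2 : ℝ) ^ (1 - 2 * κ)) ^ r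
            else η ^ 2 * 2 ^ ρ * 2 ^ (2 * q) * (1 / 2 : ℝ) ^ r)) := by
  have hrq : r ≤ q := hr.le
  have hcast : ((q - r : ℕ) : ℝ) = q - r := by push_cast [Nat.cast_sub hrq]; ring
  have hlg0 : 0 ≤ lg := by linarith
  -- (a) the factor `N + 2^{q-r}`
  have hNq : (2 : ℝ) ^ j + 2 ^ (q - r) ≤ 2 ^ j * 2 ^ (3 * ρ + 5) := by
    have h1 : (2 : ℝ) ^ (q - r) ≤ 2 ^ q := pow_le_pow_right₀ one_le_two (Nat.sub_le q r)
    have h2 : (2 : ℝ) ^ q ≤ 2 ^ j * 2 ^ (3 * ρ + 4) := by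
      rw [hqi, show i + 3 * ρ + 4 = i + (3 * ρ + 4) by ring, pow_add]
      exact mul_le_mul_of_nonneg_right (pow_le_pow_right₀ one_le_two hij) (by positivity)
    have h3 : (2 : ℝ) ^ j * 2 ^ (3 * ρ + 5) = 2 ^ j * 2 ^ (3 * ρ + 4) + 2 ^ j * 2 ^ (3 * ρ + 4) := by
      rw [show 3 * ρ + 5 = (3 * ρ + 4) + 1 by ring, pow_succ]; ring
    have h4 : (2 : ℝ) ^ j ≤ 2 ^ j * 2 ^ (3 * ρ + 4) := by
      have : (1 : ℝ) ≤ 2 ^ (3 * ρ + 4) := one_le_pow₀ one_le_two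
      nlinarith [pow_pos (show (0 : ℝ) < 2 by norm_num) j]
    linarith
  -- (b) the flat term
  have hflat : lg * (2 * (2 : ℝ) ^ (κ * q) * (2 * (2 : ℝ) ^ (κ * ((q - r : ℕ) : ℝ)))) =
      lg * (4 * (2 : ℝ) ^ (κ * q) * ((2 : ℝ) ^ (κ * q) * ((2 : ℝ) ^ (-κ)) ^ r)) := by
    have e : (2 : ℝ) ^ (κ * ((q - r : ℕ) : ℝ)) = (2 : ℝ) ^ (κ * q) * ((2 : ℝ) ^ (-κ)) ^ r := by
      rw [hcast, ← Real.rpow_natCast ((2 : ℝ) ^ (-κ)) r, ← Real.rpow_mul (by norm_num),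
        ← Real.rpow_add two_pos]
      ring_nf
    rw [e]; ring
  -- (c) the `min`
  have hqsub1 : q - (r - v) ≤ (q - r) + ρ := by omega
  have hqsub2 : ((q - (r - v) : ℕ) : ℝ) ≤ ((q - r : ℕ) : ℝ) + ρ := by exact_mod_cast hqsub1
  have hmin : min (η ^ 2 * 2 ^ (q - (r - v)) * 2 ^ (q - r))
      (2 * (2 : ℝ) ^ (κ * ((q - (r - v) : ℕ) : ℝ)) * (2 * (2 : ℝ) ^ (κ * ((q - r : ℕ) : ℝ)))) ≤
      (if r + s ≤ i then 4 * (2 : ℝ) ^ (κ * ρ) * (2 : ℝ) ^ (2 * κ * ((q - r : ℕ) : ℝ))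
        else η ^ 2 * 2 ^ ρ * 2 ^ (2 * (q - r))) := by
    split_ifs with hcase
    · refine (min_le_right _ _).trans ?_
      have e1 : (2 : ℝ) ^ (κ * ((q - (r - v) : ℕ) : ℝ)) ≤ (2 : ℝ) ^ (κ * (((q - r : ℕ) : ℝ) + ρ)) :=
        Real.rpow_le_rpow_of_exponent_le one_le_two (mul_le_mul_of_nonneg_left hqsub2 hκ0.le)
      have e2 : (2 : ℝ) ^ (κ * (((q - r : ℕ) : ℝ) + ρ)) * (2 : ℝ) ^ (κ * ((q - r : ℕ) : ℝ)) =
          (2 : ℝ) ^ (κ * ρ) * (2 : ℝ) ^ (2 * κ * ((q - r : ℕ) : ℝ)) := by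
        rw [← Real.rpow_add two_pos, ← Real.rpow_add two_pos]; ring_nf
      have hpos : 0 ≤ (2 : ℝ) ^ (κ * ((q - r : ℕ) : ℝ)) := by positivity
      calc 2 * (2 : ℝ) ^ (κ * ((q - (r - v) : ℕ) : ℝ)) * (2 * (2 : ℝ) ^ (κ * ((q - r : ℕ) : ℝ)))
          = 4 * ((2 : ℝ) ^ (κ * ((q - (r - v) : ℕ) : ℝ)) * (2 : ℝ) ^ (κ * ((q - r : ℕ) : ℝ))) := by ring
        _ ≤ 4 * ((2 : ℝ) ^ (κ * (((q - r : ℕ) : ℝ) + ρ)) * (2 : ℝ) ^ (κ * ((q - r : ℕ) : ℝ))) := by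
            gcongr
        _ = 4 * (2 : ℝ) ^ (κ * ρ) * (2 : ℝ) ^ (2 * κ * ((q - r : ℕ) : ℝ)) := by rw [e2]; ring
    · refine (min_le_left _ _).trans ?_
      have e1 : (2 : ℝ) ^ (q - (r - v)) ≤ 2 ^ ((q - r) + ρ) := pow_le_pow_right₀ one_le_two hqsub1
      have hη0 : 0 ≤ η ^ 2 := sq_nonneg _
      calc η ^ 2 * 2 ^ (q - (r - v)) * 2 ^ (q - r) ≤ η ^ 2 * 2 ^ ((q - r) + ρ) * 2 ^ (q - r) := by
            gcongr
        _ = η ^ 2 * 2 ^ ρ * 2 ^ (2 * (q - r)) := by rw [pow_add, two_mul, pow_add]; ring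
  -- (d) the last factor
  have hY : 2 * ((2 : ℝ) ^ i / 2 ^ (q - r)) + 2 ^ (r - v) * (1 + Real.log ((2 : ℝ) ^ (r - v))) ≤
      2 * 2 ^ r * lg := by
    have h1 : 2 * ((2 : ℝ) ^ i / 2 ^ (q - r)) ≤ 2 ^ r := by
      rw [mul_div_assoc', div_le_iff₀ (by positivity), ← pow_add,
        show r + (q - r) = q by omega, hqi]
      calc 2 * (2 : ℝ) ^ i = 2 ^ (i + 1) := by rw [pow_succ]; ring
        _ ≤ 2 ^ (i + 3 * ρ + 4) := pow_le_pow_right₀ one_le_two (by omega)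
    have h2 : (2 : ℝ) ^ (r - v) ≤ 2 ^ r := pow_le_pow_right₀ one_le_two (Nat.sub_le r v)
    have h3 : 0 ≤ 1 + Real.log ((2 : ℝ) ^ (r - v)) := by
      have := Real.log_nonneg (one_le_pow₀ (M₀ := ℝ) one_le_two (n := r - v)); linarith
    have h4 : (2 : ℝ) ^ (r - v) * (1 + Real.log ((2 : ℝ) ^ (r - v))) ≤ 2 ^ r * lg :=
      mul_le_mul h2 hlog h3 (by positivity)
    have h5 : (2 : ℝ) ^ r ≤ 2 ^ r * lg := by
      have := pow_pos (show (0 : ℝ) < 2 by norm_num) r; nlinarith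
    linarith
  -- (e) combine
  have hB0 : 0 ≤ (if r + s ≤ i then 4 * (2 : ℝ) ^ (κ * ρ) * (2 : ℝ) ^ (2 * κ * ((q - r : ℕ) : ℝ))
        else η ^ 2 * 2 ^ ρ * 2 ^ (2 * (q - r))) := by
    split_ifs <;> positivity
  have hmin0 : 0 ≤ min (η ^ 2 * 2 ^ (q - (r - v)) * 2 ^ (q - r))
      (2 * (2 : ℝ) ^ (κ * ((q - (r - v) : ℕ) : ℝ)) * (2 * (2 : ℝ) ^ (κ * ((q - r : ℕ) : ℝ)))) :=
    le_min (by positivity) (by positivity)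
  have hY0 : 0 ≤ 2 * ((2 : ℝ) ^ i / 2 ^ (q - r)) + 2 ^ (r - v) * (1 + Real.log ((2 : ℝ) ^ (r - v))) := by
    have := Real.log_nonneg (one_le_pow₀ (M₀ := ℝ) one_le_two (n := r - v))
    positivity
  -- the closed forms of `2^r · B₀`
  have hclosed : (2 : ℝ) ^ r * (if r + s ≤ i then 4 * (2 : ℝ) ^ (κ * ρ) * (2 : ℝ) ^ (2 * κ * ((q - r : ℕ) : ℝ))
        else η ^ 2 * 2 ^ ρ * 2 ^ (2 * (q - r))) =
      (if r + s ≤ i then 4 * (2 : ℝ) ^ (κ * ρ + 2 * κ * q) * ((2 : ℝ) ^ (1 - 2 * κ)) ^ r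
        else η ^ 2 * 2 ^ ρ * 2 ^ (2 * q) * (1 / 2 : ℝ) ^ r) := by
    split_ifs with hcase
    · have e : (2 : ℝ) ^ r * (2 : ℝ) ^ (2 * κ * ((q - r : ℕ) : ℝ)) =
          (2 : ℝ) ^ (2 * κ * q) * ((2 : ℝ) ^ (1 - 2 * κ)) ^ r := by
        rw [hcast, ← Real.rpow_natCast 2 r, ← Real.rpow_natCast ((2 : ℝ) ^ (1 - 2 * κ)) r,
          ← Real.rpow_mul (by norm_num), ← Real.rpow_add two_pos, ← Real.rpow_add two_pos]
        ring_nf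
      calc (2 : ℝ) ^ r * (4 * (2 : ℝ) ^ (κ * ρ) * (2 : ℝ) ^ (2 * κ * ((q - r : ℕ) : ℝ)))
          = 4 * (2 : ℝ) ^ (κ * ρ) * ((2 : ℝ) ^ r * (2 : ℝ) ^ (2 * κ * ((q - r : ℕ) : ℝ))) := by ring
        _ = 4 * (2 : ℝ) ^ (κ * ρ) * ((2 : ℝ) ^ (2 * κ * q) * ((2 : ℝ) ^ (1 - 2 * κ)) ^ r) := by rw [e]
        _ = 4 * (2 : ℝ) ^ (κ * ρ + 2 * κ * q) * ((2 : ℝ) ^ (1 - 2 * κ)) ^ r := by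
            rw [Real.rpow_add two_pos]; ring
    · have e : (2 : ℝ) ^ r * 2 ^ (2 * (q - r)) = 2 ^ (2 * q) * (1 / 2 : ℝ) ^ r := by
        have h1 : (2 : ℝ) ^ r * 2 ^ (2 * (q - r)) * 2 ^ r = 2 ^ (2 * q) := by
          rw [← pow_add, ← pow_add]; congr 1; omega
        have h2 : (1 / 2 : ℝ) ^ r * 2 ^ r = 1 := by rw [← mul_pow]; norm_num
        have h3 : (2 : ℝ) ^ r ≠ 0 := by positivity
        rw [one_div_pow, mul_one_div, eq_div_iff h3]
        exact h1
      calc (2 : ℝ) ^ r * (η ^ 2 * 2 ^ ρ * 2 ^ (2 * (q - r))) = η ^ 2 * 2 ^ ρ * ((2 : ℝ) ^ r * 2 ^ (2 * (q - r))) := by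
            ring
        _ = η ^ 2 * 2 ^ ρ * 2 ^ (2 * q) * (1 / 2 : ℝ) ^ r := by rw [e]; ring
  calc ((2 : ℝ) ^ j + 2 ^ (q - r)) *
        (lg * (2 * (2 : ℝ) ^ (κ * q) * (2 * (2 : ℝ) ^ (κ * ((q - r : ℕ) : ℝ)))) +
          2 * (min (η ^ 2 * 2 ^ (q - (r - v)) * 2 ^ (q - r))
              (2 * (2 : ℝ) ^ (κ * ((q - (r - v) : ℕ) : ℝ)) * (2 * (2 : ℝ) ^ (κ * ((q - r : ℕ) : ℝ)))) *
            (2 * ((2 : ℝ) ^ i / 2 ^ (q - r)) + 2 ^ (r - v) * (1 + Real.log ((2 : ℝ) ^ (r - v))))))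
      ≤ ((2 : ℝ) ^ j * 2 ^ (3 * ρ + 5)) *
        (lg * (4 * (2 : ℝ) ^ (κ * q) * ((2 : ℝ) ^ (κ * q) * ((2 : ℝ) ^ (-κ)) ^ r)) +
          2 * ((if r + s ≤ i then 4 * (2 : ℝ) ^ (κ * ρ) * (2 : ℝ) ^ (2 * κ * ((q - r : ℕ) : ℝ))
            else η ^ 2 * 2 ^ ρ * 2 ^ (2 * (q - r))) * (2 * 2 ^ r * lg))) := by
        rw [hflat]
        refine mul_le_mul hNq (add_le_add le_rfl ?_) (by positivity) (by positivity)
        exact mul_le_mul_of_nonneg_left (mul_le_mul hmin hY hY0 hB0) (by norm_num)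
    _ = (2 : ℝ) ^ j * 2 ^ (3 * ρ + 5) * lg *
        (4 * (2 : ℝ) ^ (κ * q) * ((2 : ℝ) ^ (κ * q) * ((2 : ℝ) ^ (-κ)) ^ r) +
          4 * ((2 : ℝ) ^ r * (if r + s ≤ i then 4 * (2 : ℝ) ^ (κ * ρ) * (2 : ℝ) ^ (2 * κ * ((q - r : ℕ) : ℝ))
            else η ^ 2 * 2 ^ ρ * 2 ^ (2 * (q - r))))) := by ring
    _ = _ := by rw [hclosed]


set_option maxHeartbeats 1600000 in
/-- **Type-II, unshifted window, squared, in closed-exponent form.** From the tree's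
`MoebiusWalshTypeII.boxSum_sq_typeII_zero_le` (Bourgain 2013, §2 (2.1)–(2.22)) with carry slack
`t = 2ρ + 3` (`q = i + 3ρ + 4` digits), summing the geometric series of the core count and choosing
the switch point `r₀ = i - s`, `s = min(i, ⌊c₂ w⌋ + 1)` between the progression branch (Lemma 4)
and the sup branch (Lemma 2) of the resonant term ((2.20)/(2.21)):
`boxSum² ≤ (2^i 2^j)² (8·2^{-ρ} + (1 + log 2^q) C_κ 2^{10ρ+15} (2^{-c₀ i} + 2^{-c₀ w}))`,
`w = |T ∩ [0, q)|`, `c₀ = (1 - 2κ)c₂`, `C_κ = 4/(1-2^{-κ}) + 16 b/(b-1) + 37`, `b = 2^{1-2κ}`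
(`κ = walshL1Exponent < 1/2`, `c₂ = walshSupExponent`). [cite: Bourgain2013MoebiusWalsh, §2 (2.13)–(2.22), (2.28)–(2.29)] -/
theorem boxSum_sq_le_clean_zero (T : Finset ℕ) {i j ρ : ℕ} (hij : i ≤ j) (hρj : ρ ≤ j)
    (ε β : ℕ → ℝ) (hε : ∀ a, |ε a| ≤ 1) (hβ : ∀ b, |β b| ≤ 1) :
    (boxSum T i j ε β) ^ 2 ≤
      ((2 : ℝ) ^ i * 2 ^ j) ^ 2 *
        (8 * (2 : ℝ) ^ (-(ρ : ℝ)) +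
          (1 + Real.log ((2 : ℝ) ^ (i + ρ + 1 + (2 * ρ + 3)))) *
            (4 / (1 - (2 : ℝ) ^ (-walshL1Exponent)) +
              16 * ((2 : ℝ) ^ (1 - 2 * walshL1Exponent) / ((2 : ℝ) ^ (1 - 2 * walshL1Exponent) - 1)) + 37) *
            (2 : ℝ) ^ ((10 * ρ + 15 : ℕ) : ℝ) *
            ((2 : ℝ) ^ (-((1 - 2 * walshL1Exponent) * walshSupExponent * i)) +
              (2 : ℝ) ^ (-((1 - 2 * walshL1Exponent) * walshSupExponent *
                ((T.filter fun x => 0 ≤ x ∧ x < i + ρ + 1 + (2 * ρ + 3)).card : ℝ))))) := by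
  classical
  have h := boxSum_sq_typeII_zero_le T (i := i) (2 * ρ + 3) hρj ε β hε hβ
  set q : ℕ := i + ρ + 1 + (2 * ρ + 3) with hq
  set κ : ℝ := walshL1Exponent with hκ
  set c₂ : ℝ := walshSupExponent with hc₂
  set A' := (T.filter fun x => 0 ≤ x ∧ x < i + ρ + 1 + (2 * ρ + 3)).attachFin
    (lt_of_mem_filter_window T (i + ρ + 1 + (2 * ρ + 3))) with hA'
  set η : ℝ := 2 * (2 : ℝ) ^ (-(c₂ * (A'.card : ℝ))) with hη
  -- constants
  have hκ0 : 0 < κ := walshL1Exponent_pos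
  have hκh : κ < 1 / 2 := walshL1Exponent_lt_half
  have hc₂0 : 0 < c₂ := walshSupExponent_pos
  set w : ℕ := (T.filter fun x => 0 ≤ x ∧ x < i + ρ + 1 + (2 * ρ + 3)).card with hw
  have hcardA : A'.card = w := by rw [hA', Finset.card_attachFin]
  rw [hcardA] at hη
  set x₁ : ℝ := (2 : ℝ) ^ (-κ) with hx₁
  have hx₁0 : 0 < x₁ := by positivity
  have hx₁1 : x₁ < 1 := Real.rpow_lt_one_of_one_lt_of_neg one_lt_two (by linarith)
  set Cκ₁ : ℝ := 1 / (1 - x₁) with hCκ₁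
  have hCκ₁0 : 0 < Cκ₁ := by rw [hCκ₁]; exact div_pos one_pos (by linarith)
  set b : ℝ := (2 : ℝ) ^ (1 - 2 * κ) with hb
  have hb1 : 1 < b := Real.one_lt_rpow one_lt_two (by linarith)
  set Cb : ℝ := b / (b - 1) with hCb
  have hCb0 : 0 < Cb := by rw [hCb]; exact div_pos (by linarith) (by linarith)
  set Cκ : ℝ := 4 / (1 - x₁) + 16 * Cb + 37 with hCκ
  have hCκeq : Cκ = 4 * Cκ₁ + 16 * Cb + 37 := by rw [hCκ, hCκ₁]; ring
  set c₀ : ℝ := (1 - 2 * κ) * c₂ with hc₀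
  have hc₀0 : 0 < c₀ := by rw [hc₀]; exact mul_pos (by linarith) hc₂0
  have h12κ : 0 ≤ 1 - 2 * κ := by linarith
  have hc₀1 : c₀ ≤ 1 - 2 * κ := by
    rw [hc₀]
    have hc₂1 : c₂ ≤ 1 := walshSupExponent_le_one'
    have := mul_le_mul_of_nonneg_left hc₂1 h12κ
    linarith only [this]
  have hc₀2 : c₀ ≤ c₂ := by
    rw [hc₀]
    have := mul_le_mul_of_nonneg_right (show 1 - 2 * κ ≤ 1 by linarith) hc₂0.le
    linarith only [this]
  set lg : ℝ := 1 + Real.log ((2 : ℝ) ^ q) with hlg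
  have hlg1 : 1 ≤ lg := by
    have := Real.log_nonneg (one_le_pow₀ (M₀ := ℝ) one_le_two (n := q)); rw [hlg]; linarith
  -- casts in `h`
  have eL : ((2 ^ ρ : ℕ) : ℝ) = (2 : ℝ) ^ ρ := by push_cast; ring
  have eN : ((2 ^ (j + 1) : ℕ) : ℝ) - ((2 ^ j : ℕ) : ℝ) = (2 : ℝ) ^ j := by push_cast; ring
  have eq0 : ((q - 0 : ℕ) : ℝ) = q := by rw [Nat.sub_zero]
  simp only [eL, eN, eq0] at h
  -- basic sizes
  have hqi : q = i + 3 * ρ + 4 := by rw [hq]; ring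
  have h2q : (2 : ℝ) ^ q = 2 ^ i * 2 ^ (3 * ρ + 4) := by rw [hqi, ← pow_add]; ring_nf
  have hMpos : (0 : ℝ) < 2 ^ i := by positivity
  have hNpos : (0 : ℝ) < 2 ^ j := by positivity
  have hij' : (2 : ℝ) ^ i ≤ 2 ^ j := pow_le_pow_right₀ one_le_two hij
  -- the switch point
  set s : ℕ := min i (⌊c₂ * w⌋₊ + 1) with hs
  have hsi : s ≤ i := min_le_left _ _
  have hs_le : (s : ℝ) ≤ c₂ * w + 1 := by
    have h1 : s ≤ ⌊c₂ * w⌋₊ + 1 := min_le_right _ _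
    have h2 : ((⌊c₂ * w⌋₊ : ℕ) : ℝ) ≤ c₂ * w := Nat.floor_le (by positivity)
    have h3 : (s : ℝ) ≤ ((⌊c₂ * w⌋₊ + 1 : ℕ) : ℝ) := by exact_mod_cast h1
    push_cast at h3; linarith
  -- `2^{-(1-2κ)s} ≤ 2^{-c₀ i} + 2^{-c₀ w}`
  have hs_split : (2 : ℝ) ^ (-((1 - 2 * κ) * s)) ≤ (2 : ℝ) ^ (-(c₀ * i)) + (2 : ℝ) ^ (-(c₀ * w)) := by
    have hpos1 : 0 ≤ (2 : ℝ) ^ (-(c₀ * i)) := by positivity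
    have hpos2 : 0 ≤ (2 : ℝ) ^ (-(c₀ * w)) := by positivity
    rcases Nat.le_total i (⌊c₂ * w⌋₊ + 1) with hcase | hcase
    · have hsi' : s = i := by rw [hs, min_eq_left hcase]
      have : (2 : ℝ) ^ (-((1 - 2 * κ) * s)) ≤ (2 : ℝ) ^ (-(c₀ * i)) := by
        rw [hsi']
        refine Real.rpow_le_rpow_of_exponent_le one_le_two ?_
        have hi0 : (0 : ℝ) ≤ i := Nat.cast_nonneg _
        have := mul_le_mul_of_nonneg_right hc₀1 hi0
        linarith only [this]
      linarith only [this, hpos2]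
    · have hsw : s = ⌊c₂ * w⌋₊ + 1 := by rw [hs, min_eq_right hcase]
      have hsw' : c₂ * w < s := by
        rw [hsw]; push_cast; exact Nat.lt_floor_add_one _
      have : (2 : ℝ) ^ (-((1 - 2 * κ) * s)) ≤ (2 : ℝ) ^ (-(c₀ * w)) := by
        refine Real.rpow_le_rpow_of_exponent_le one_le_two ?_
        rw [hc₀]
        have := mul_le_mul_of_nonneg_left hsw'.le h12κ
        linarith only [this]
      linarith only [this, hpos1]
  -- `η² ≤ 4·2^{-c₀ w}` and `η² 2^s ≤ 8·2^{-c₀ w}`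
  have hη2 : η ^ 2 = 4 * (2 : ℝ) ^ (-(2 * c₂ * w)) := by
    have e : ((2 : ℝ) ^ (-(c₂ * w))) ^ 2 = (2 : ℝ) ^ (-(2 * c₂ * w)) := by
      rw [← Real.rpow_natCast, ← Real.rpow_mul (by norm_num)]; congr 1; push_cast; ring
    rw [hη, mul_pow, e]; norm_num
  have hηc₀ : η ^ 2 ≤ 4 * (2 : ℝ) ^ (-(c₀ * w)) := by
    rw [hη2]
    refine mul_le_mul_of_nonneg_left (Real.rpow_le_rpow_of_exponent_le one_le_two ?_) (by norm_num)
    have hw0 : (0 : ℝ) ≤ w := Nat.cast_nonneg _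
    have h1 := mul_le_mul_of_nonneg_right hc₀2 hw0
    have h2 : 0 ≤ c₂ * w := by positivity
    linarith only [h1, h2]
  have hc₀w : c₀ * w ≤ c₂ * w := mul_le_mul_of_nonneg_right hc₀2 (Nat.cast_nonneg _)
  have hηs : η ^ 2 * 2 ^ s ≤ 8 * (2 : ℝ) ^ (-(c₀ * w)) := by
    rw [hη2, ← Real.rpow_natCast 2 s, mul_assoc, ← Real.rpow_add two_pos]
    have : (2 : ℝ) ^ (-(2 * c₂ * w) + s) ≤ (2 : ℝ) ^ (-(c₀ * w) + 1) := by
      refine Real.rpow_le_rpow_of_exponent_le one_le_two ?_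
      linarith only [hs_le, hc₀w]
    rw [Real.rpow_add two_pos _ 1, Real.rpow_one] at this
    linarith
  -- `v₂(h) < ρ`, and the exponent comparison `q - (r - v) ≤ (q - r) + ρ`
  have hqsub : ∀ h ∈ Ico 1 (2 ^ ρ), ∀ r ∈ range q,
      q - (r - h.factorization 2) ≤ (q - r) + ρ ∧ r - h.factorization 2 ≤ r := by
    intro h hh r hr
    have hv := factorization_two_lt_of_mem_Ico hh
    rw [Finset.mem_range] at hr
    constructor <;> omega
  -- (B) the summand bound
  set B₁ : ℕ → ℝ := fun r => if r + s ≤ i then 4 * (2 : ℝ) ^ (κ * ρ + 2 * κ * q) * b ^ r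
    else η ^ 2 * 2 ^ ρ * 2 ^ (2 * q) * (1 / 2 : ℝ) ^ r with hB₁
  set G : ℕ → ℝ := fun r => (2 : ℝ) ^ j * 2 ^ (3 * ρ + 5) * lg *
    (4 * (2 : ℝ) ^ (κ * q) * ((2 : ℝ) ^ (κ * q) * x₁ ^ r) + 4 * B₁ r) with hG
  have hterm : ∀ x ∈ Ico 1 (2 ^ ρ), ∀ r ∈ range q,
      ((2 : ℝ) ^ j + 2 ^ (q - r)) *
        (lg * (2 * (2 : ℝ) ^ (κ * q) * (2 * (2 : ℝ) ^ (κ * ((q - r : ℕ) : ℝ)))) +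
          2 * (min (η ^ 2 * 2 ^ (q - (r - x.factorization 2)) * 2 ^ (q - r))
              (2 * (2 : ℝ) ^ (κ * ((q - (r - x.factorization 2) : ℕ) : ℝ)) *
                (2 * (2 : ℝ) ^ (κ * ((q - r : ℕ) : ℝ)))) *
            (2 * ((2 : ℝ) ^ i / 2 ^ (q - r)) +
              2 ^ (r - x.factorization 2) * (1 + Real.log ((2 : ℝ) ^ (r - x.factorization 2)))))) ≤
      G r := by
    intro x hx r hr
    have hv := factorization_two_lt_of_mem_Ico hx
    have hr' := Finset.mem_range.1 hr
    have hlog : 1 + Real.log ((2 : ℝ) ^ (r - x.factorization 2)) ≤ lg := by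
      rw [hlg]
      have : (2 : ℝ) ^ (r - x.factorization 2) ≤ 2 ^ q :=
        pow_le_pow_right₀ one_le_two (by omega)
      have := Real.log_le_log (by positivity) this
      linarith
    have := core_summand_le (s := s) (η := η) hκ0 hlg1 hqi hij hr' hv hlog
    simp only [hG, hB₁]
    exact this
  -- (C) the sum over `r`
  have hG0 : ∀ r, 0 ≤ B₁ r := by
    intro r; simp only [hB₁]; split_ifs <;> positivity
  set RB : ℝ := (2 : ℝ) ^ j * 2 ^ (3 * ρ + 5) * lg *
    (4 * (2 : ℝ) ^ (κ * q) * ((2 : ℝ) ^ (κ * q) * Cκ₁) +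
      4 * (4 * (2 : ℝ) ^ (κ * ρ + 2 * κ * q) * (b ^ (i - s) * Cb) +
        η ^ 2 * 2 ^ ρ * 2 ^ (2 * q) * (1 / 2 : ℝ) ^ (i - s))) with hRB
  have hsum_r : ∑ r ∈ range q, G r ≤ RB := by
    have hs1 : ∑ r ∈ range q, x₁ ^ r ≤ Cκ₁ := sum_range_pow_le_inv hx₁0.le hx₁1 q
    have hsA : ∑ r ∈ (range q).filter (fun r => r + s ≤ i), b ^ r ≤ b ^ (i - s) * Cb := by
      calc ∑ r ∈ (range q).filter (fun r => r + s ≤ i), b ^ r ≤ ∑ r ∈ range (i - s + 1), b ^ r := by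
            refine Finset.sum_le_sum_of_subset_of_nonneg ?_ fun r _ _ => by positivity
            intro r hr
            simp only [Finset.mem_filter, Finset.mem_range] at hr ⊢
            omega
        _ ≤ b ^ (i - s) * (b / (b - 1)) := sum_range_succ_pow_le hb1 (i - s)
    have hsB : ∑ r ∈ (range q).filter (fun r => ¬ r + s ≤ i), (1 / 2 : ℝ) ^ r ≤ (1 / 2 : ℝ) ^ (i - s) := by
      calc ∑ r ∈ (range q).filter (fun r => ¬ r + s ≤ i), (1 / 2 : ℝ) ^ r ≤ 2 * (1 / 2 : ℝ) ^ (i - s + 1) := by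
            refine sum_half_pow_le _ (i - s + 1) fun r hr => ?_
            simp only [Finset.mem_filter, Finset.mem_range] at hr
            omega
        _ = (1 / 2 : ℝ) ^ (i - s) := by rw [pow_succ]; ring
    have hs2 : ∑ r ∈ range q, B₁ r ≤ 4 * (2 : ℝ) ^ (κ * ρ + 2 * κ * q) * (b ^ (i - s) * Cb) +
        η ^ 2 * 2 ^ ρ * 2 ^ (2 * q) * (1 / 2 : ℝ) ^ (i - s) := by
      simp only [hB₁]
      rw [Finset.sum_ite, ← Finset.mul_sum, ← Finset.mul_sum]
      have h1 := mul_le_mul_of_nonneg_left hsA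
        (by positivity : (0 : ℝ) ≤ 4 * (2 : ℝ) ^ (κ * ρ + 2 * κ * q))
      have h2 := mul_le_mul_of_nonneg_left hsB (by positivity : (0 : ℝ) ≤ η ^ 2 * 2 ^ ρ * 2 ^ (2 * q))
      linarith
    have hsplit : ∑ r ∈ range q, G r = (2 : ℝ) ^ j * 2 ^ (3 * ρ + 5) * lg *
        (4 * (2 : ℝ) ^ (κ * q) * ((2 : ℝ) ^ (κ * q) * ∑ r ∈ range q, x₁ ^ r) +
          4 * ∑ r ∈ range q, B₁ r) := by
      simp only [hG]
      rw [← Finset.mul_sum, Finset.sum_add_distrib, Finset.mul_sum, Finset.mul_sum, Finset.mul_sum]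
    rw [hsplit, hRB]
    refine mul_le_mul_of_nonneg_left ?_ (by positivity)
    have h1 := mul_le_mul_of_nonneg_left (mul_le_mul_of_nonneg_left hs1
      (by positivity : (0 : ℝ) ≤ (2 : ℝ) ^ (κ * q))) (by positivity : (0 : ℝ) ≤ 4 * (2 : ℝ) ^ (κ * q))
    linarith
  -- the sum over `h`
  have hRB0 : 0 ≤ RB := by rw [hRB]; positivity
  have hFR : ∑ x ∈ Ico 1 (2 ^ ρ), ∑ r ∈ range q,
      ((2 : ℝ) ^ j + 2 ^ (q - r)) *
        (lg * (2 * (2 : ℝ) ^ (κ * q) * (2 * (2 : ℝ) ^ (κ * ((q - r : ℕ) : ℝ)))) +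
          2 * (min (η ^ 2 * 2 ^ (q - (r - x.factorization 2)) * 2 ^ (q - r))
              (2 * (2 : ℝ) ^ (κ * ((q - (r - x.factorization 2) : ℕ) : ℝ)) *
                (2 * (2 : ℝ) ^ (κ * ((q - r : ℕ) : ℝ)))) *
            (2 * ((2 : ℝ) ^ i / 2 ^ (q - r)) +
              2 ^ (r - x.factorization 2) * (1 + Real.log ((2 : ℝ) ^ (r - x.factorization 2)))))) ≤
      2 ^ ρ * RB := by
    calc _ ≤ ∑ x ∈ Ico 1 (2 ^ ρ), ∑ r ∈ range q, G r :=
          Finset.sum_le_sum fun x hx => Finset.sum_le_sum fun r hr => hterm x hx r hr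
      _ ≤ ∑ _x ∈ Ico 1 (2 ^ ρ), RB := Finset.sum_le_sum fun x _ => hsum_r
      _ = ((2 ^ ρ - 1 : ℕ) : ℝ) * RB := by rw [Finset.sum_const, Nat.card_Ico, nsmul_eq_mul]
      _ ≤ 2 ^ ρ * RB := by
          refine mul_le_mul_of_nonneg_right ?_ hRB0
          have : ((2 ^ ρ - 1 : ℕ) : ℝ) ≤ ((2 ^ ρ : ℕ) : ℝ) := by exact_mod_cast Nat.sub_le _ _
          push_cast at this
          exact this
  -- (D) the algebra
  set Z : ℝ := (2 : ℝ) ^ (-(c₀ * i)) + (2 : ℝ) ^ (-(c₀ * w)) with hZ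
  have hZi : (2 : ℝ) ^ (-(c₀ * i)) ≤ Z := le_add_of_nonneg_right (by positivity)
  have hZw : (2 : ℝ) ^ (-(c₀ * w)) ≤ Z := le_add_of_nonneg_left (by positivity)
  have hZ0 : 0 ≤ Z := by positivity
  set P11 : ℝ := (2 : ℝ) ^ (11 * ρ + 13) with hP11
  set MN : ℝ := (2 : ℝ) ^ i * 2 ^ j with hMN
  have hMN0 : 0 < MN := by positivity
  have hρneg : (2 : ℝ) ^ (-(ρ : ℝ)) = ((2 : ℝ) ^ ρ)⁻¹ := by
    rw [Real.rpow_neg (by norm_num), Real.rpow_natCast]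
  have hρneg1 : (2 : ℝ) ^ (-(ρ : ℝ)) ≤ 1 := by
    rw [hρneg]; exact inv_le_one_of_one_le₀ (one_le_pow₀ one_le_two)
  have hρneg0 : 0 < (2 : ℝ) ^ (-(ρ : ℝ)) := by positivity
  -- `1 ≤ 2^j 2^{-c₀ i}`
  have hc₀le1 : c₀ ≤ 1 := by linarith
  have hj_ci : 1 ≤ (2 : ℝ) ^ j * (2 : ℝ) ^ (-(c₀ * i)) := by
    have h1 : (2 : ℝ) ^ (-(j : ℝ)) ≤ (2 : ℝ) ^ (-(c₀ * i)) := by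
      refine Real.rpow_le_rpow_of_exponent_le one_le_two ?_
      have hij2 : (i : ℝ) ≤ j := by exact_mod_cast hij
      have hi0 : (0 : ℝ) ≤ i := Nat.cast_nonneg _
      have := mul_le_mul_of_nonneg_right hc₀le1 hi0
      linarith only [this, hij2]
    have h2 : (2 : ℝ) ^ j * (2 : ℝ) ^ (-(j : ℝ)) = 1 := by
      rw [← Real.rpow_natCast, ← Real.rpow_add two_pos]; simp
    calc (1 : ℝ) = 2 ^ j * (2 : ℝ) ^ (-(j : ℝ)) := h2.symm
      _ ≤ 2 ^ j * (2 : ℝ) ^ (-(c₀ * i)) := mul_le_mul_of_nonneg_left h1 (by positivity)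
  -- powers of two against `P11`
  have hpow_le : ∀ {m : ℕ}, m ≤ 11 * ρ + 13 → (2 : ℝ) ^ m ≤ P11 := fun hm =>
    pow_le_pow_right₀ one_le_two hm
  -- the `κ`-exponent bounds
  have hκexp1 : (2 : ℝ) ^ (2 * κ * ((3 * ρ + 4 : ℕ) : ℝ)) ≤ 2 ^ (3 * ρ + 4) := by
    rw [← Real.rpow_natCast 2 (3 * ρ + 4)]
    refine Real.rpow_le_rpow_of_exponent_le one_le_two ?_
    have hX : (0 : ℝ) ≤ ((3 * ρ + 4 : ℕ) : ℝ) := Nat.cast_nonneg _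
    have := mul_le_mul_of_nonneg_right (show 2 * κ ≤ 1 by linarith) hX
    linarith only [this]
  have hκexp2 : (2 : ℝ) ^ (κ * ρ + 2 * κ * ((3 * ρ + 4 : ℕ) : ℝ)) ≤ 2 ^ (4 * ρ + 4) := by
    rw [← Real.rpow_natCast 2 (4 * ρ + 4)]
    refine Real.rpow_le_rpow_of_exponent_le one_le_two ?_
    have hρ0 : (0 : ℝ) ≤ (ρ : ℝ) := Nat.cast_nonneg _
    push_cast
    have h1 := mul_le_mul_of_nonneg_right (show κ ≤ 1 by linarith) hρ0
    have h2 := mul_le_mul_of_nonneg_right (show 2 * κ ≤ 1 by linarith)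
      (show (0 : ℝ) ≤ 3 * (ρ : ℝ) + 4 by positivity)
    linarith only [h1, h2]
  have hqcast : (q : ℝ) = i + ((3 * ρ + 4 : ℕ) : ℝ) := by rw [hqi]; push_cast; ring
  -- ERR
  have hERR : 2 * (2 : ℝ) ^ ρ * (2 ^ i * ((2 ^ j / 2 ^ (ρ + (2 * ρ + 3)) + 2) * (2 ^ (ρ + 1) + 1))) ≤
      MN * (2 : ℝ) ^ (-(ρ : ℝ)) + MN * lg * P11 * Z := by
    have h1 : (2 : ℝ) ^ (ρ + 1) + 1 ≤ 2 ^ (ρ + 2) := by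
      have : (1 : ℝ) ≤ 2 ^ (ρ + 1) := one_le_pow₀ one_le_two
      have e : (2 : ℝ) ^ (ρ + 2) = 2 ^ (ρ + 1) + 2 ^ (ρ + 1) := by ring
      linarith only [this, e]
    have h2 : 2 * (2 : ℝ) ^ ρ * 2 ^ (ρ + 2) = 2 ^ (2 * ρ + 3) := by
      rw [show 2 * (2 : ℝ) ^ ρ = 2 ^ (ρ + 1) by rw [pow_succ]; ring, ← pow_add]; ring_nf
    have h3 : (2 : ℝ) ^ (2 * ρ + 3) * (2 ^ j / 2 ^ (ρ + (2 * ρ + 3))) = 2 ^ j * (2 : ℝ) ^ (-(ρ : ℝ)) := by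
      rw [hρneg, pow_add 2 ρ (2 * ρ + 3)]
      field_simp
    have h5 : (2 : ℝ) ^ (2 * ρ + 4) ≤ P11 := hpow_le (by omega)
    have hfrac0 : 0 ≤ (2 : ℝ) ^ j / 2 ^ (ρ + (2 * ρ + 3)) + 2 := by positivity
    calc 2 * (2 : ℝ) ^ ρ * (2 ^ i * ((2 ^ j / 2 ^ (ρ + (2 * ρ + 3)) + 2) * (2 ^ (ρ + 1) + 1)))
        ≤ 2 * (2 : ℝ) ^ ρ * (2 ^ i * ((2 ^ j / 2 ^ (ρ + (2 * ρ + 3)) + 2) * 2 ^ (ρ + 2))) := by gcongr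
      _ = 2 ^ i * (2 * (2 : ℝ) ^ ρ * 2 ^ (ρ + 2)) * (2 ^ j / 2 ^ (ρ + (2 * ρ + 3))) +
            2 ^ i * ((2 * (2 : ℝ) ^ ρ * 2 ^ (ρ + 2)) * 2) := by ring
      _ = 2 ^ i * (2 ^ j * (2 : ℝ) ^ (-(ρ : ℝ))) + 2 ^ i * 2 ^ (2 * ρ + 4) := by
          rw [h2, mul_assoc (2 ^ i : ℝ) _ _, h3, show (2 : ℝ) ^ (2 * ρ + 3) * 2 = 2 ^ (2 * ρ + 4) by
            ring]
      _ ≤ MN * (2 : ℝ) ^ (-(ρ : ℝ)) + MN * lg * P11 * Z := by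
          have hA : (2 : ℝ) ^ i * 2 ^ (2 * ρ + 4) ≤ MN * lg * P11 * Z := by
            have e1 : (2 : ℝ) ^ i * 2 ^ (2 * ρ + 4) ≤ 2 ^ i * P11 * (2 ^ j * (2 : ℝ) ^ (-(c₀ * i))) := by
              have := mul_le_mul h5 hj_ci zero_le_one (by positivity)
              have h0 : (0 : ℝ) ≤ 2 ^ i := by positivity
              have h6 := mul_le_mul_of_nonneg_left this h0
              linarith only [h6]
            have e2 : (2 : ℝ) ^ i * P11 * (2 ^ j * (2 : ℝ) ^ (-(c₀ * i))) = MN * 1 * P11 * (2 : ℝ) ^ (-(c₀ * i)) := by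
              rw [hMN]; ring
            rw [e2] at e1
            have e3 : MN * 1 * P11 * (2 : ℝ) ^ (-(c₀ * i)) ≤ MN * lg * P11 * Z := by
              gcongr
            linarith only [e1, e3]
          have e : (2 : ℝ) ^ i * (2 ^ j * (2 : ℝ) ^ (-(ρ : ℝ))) = MN * (2 : ℝ) ^ (-(ρ : ℝ)) := by
            rw [hMN]; ring
          linarith only [hA, e]
  -- D
  have hD : (2 : ℝ) ^ ρ * (2 ^ j * η ^ 2 * (2 * 2 ^ ρ * 2 ^ i + 2 ^ q * lg)) ≤ MN * lg * P11 * (4 * Z) := by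
    have h1 : 2 * (2 : ℝ) ^ ρ * 2 ^ i + 2 ^ q * lg ≤ 2 ^ i * lg * 2 ^ (3 * ρ + 5) := by
      have e1 : 2 * (2 : ℝ) ^ ρ ≤ 2 ^ (3 * ρ + 4) := by
        rw [show 2 * (2 : ℝ) ^ ρ = 2 ^ (ρ + 1) by rw [pow_succ]; ring]
        exact pow_le_pow_right₀ one_le_two (by omega)
      have e2 : (2 : ℝ) ^ (3 * ρ + 5) = 2 ^ (3 * ρ + 4) + 2 ^ (3 * ρ + 4) := by
        rw [show 3 * ρ + 5 = (3 * ρ + 4) + 1 by ring, pow_succ]; ring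
      rw [h2q, e2]
      have h0 : (0 : ℝ) ≤ 2 ^ i := by positivity
      have h34 : (0 : ℝ) ≤ 2 ^ (3 * ρ + 4) := by positivity
      have h7 := mul_le_mul_of_nonneg_left e1 h0
      have h8 : (2 : ℝ) ^ i * 2 ^ (3 * ρ + 4) ≤ 2 ^ i * 2 ^ (3 * ρ + 4) * lg :=
        le_mul_of_one_le_right (mul_nonneg h0 h34) hlg1
      linarith only [h7, h8]
    have h2 : (2 : ℝ) ^ (4 * ρ + 5) ≤ P11 := hpow_le (by omega)
    have hη0 : 0 ≤ η ^ 2 := sq_nonneg _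
    calc (2 : ℝ) ^ ρ * (2 ^ j * η ^ 2 * (2 * 2 ^ ρ * 2 ^ i + 2 ^ q * lg))
        ≤ (2 : ℝ) ^ ρ * (2 ^ j * η ^ 2 * (2 ^ i * lg * 2 ^ (3 * ρ + 5))) := by gcongr
      _ = MN * lg * (2 ^ ρ * 2 ^ (3 * ρ + 5)) * η ^ 2 := by rw [hMN]; ring
      _ = MN * lg * 2 ^ (4 * ρ + 5) * η ^ 2 := by rw [← pow_add]; ring_nf
      _ ≤ MN * lg * P11 * (4 * (2 : ℝ) ^ (-(c₀ * w))) := by gcongr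
      _ ≤ MN * lg * P11 * (4 * Z) := by gcongr
  -- FR: the three terms of `RB`
  have hT1 : 4 * (2 : ℝ) ^ (κ * q) * ((2 : ℝ) ^ (κ * q) * Cκ₁) ≤
      2 ^ i * 2 ^ (3 * ρ + 4) * (4 * Cκ₁) * (2 : ℝ) ^ (-(c₀ * i)) := by
    have e1 : (2 : ℝ) ^ (κ * q) * (2 : ℝ) ^ (κ * q) =
        (2 : ℝ) ^ (2 * κ * i) * (2 : ℝ) ^ (2 * κ * ((3 * ρ + 4 : ℕ) : ℝ)) := by
      rw [← Real.rpow_add two_pos, ← Real.rpow_add two_pos, hqcast]; ring_nf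
    have e2 : (2 : ℝ) ^ (2 * κ * i) ≤ 2 ^ i * (2 : ℝ) ^ (-(c₀ * i)) := by
      rw [← Real.rpow_natCast 2 i, ← Real.rpow_add two_pos]
      refine Real.rpow_le_rpow_of_exponent_le one_le_two ?_
      have : (0 : ℝ) ≤ i := Nat.cast_nonneg _
      nlinarith
    calc 4 * (2 : ℝ) ^ (κ * q) * ((2 : ℝ) ^ (κ * q) * Cκ₁)
        = 4 * Cκ₁ * ((2 : ℝ) ^ (κ * q) * (2 : ℝ) ^ (κ * q)) := by ring
      _ = 4 * Cκ₁ * ((2 : ℝ) ^ (2 * κ * i) * (2 : ℝ) ^ (2 * κ * ((3 * ρ + 4 : ℕ) : ℝ))) := by rw [e1]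
      _ ≤ 4 * Cκ₁ * ((2 ^ i * (2 : ℝ) ^ (-(c₀ * i))) * 2 ^ (3 * ρ + 4)) := by gcongr
      _ = 2 ^ i * 2 ^ (3 * ρ + 4) * (4 * Cκ₁) * (2 : ℝ) ^ (-(c₀ * i)) := by ring
  have hT2 : 4 * (4 * (2 : ℝ) ^ (κ * ρ + 2 * κ * q) * (b ^ (i - s) * Cb)) ≤
      2 ^ i * 2 ^ (4 * ρ + 4) * (16 * Cb) * Z := by
    have hscast : ((i - s : ℕ) : ℝ) = i - s := by push_cast [Nat.cast_sub hsi]; ring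
    have e1 : b ^ (i - s) = (2 : ℝ) ^ ((1 - 2 * κ) * ((i : ℝ) - s)) := by
      rw [hb, ← Real.rpow_natCast, ← Real.rpow_mul (by norm_num), hscast]
    have e2 : (2 : ℝ) ^ (κ * ρ + 2 * κ * q) * (2 : ℝ) ^ ((1 - 2 * κ) * ((i : ℝ) - s)) =
        (2 : ℝ) ^ (κ * ρ + 2 * κ * ((3 * ρ + 4 : ℕ) : ℝ)) * 2 ^ i * (2 : ℝ) ^ (-((1 - 2 * κ) * s)) := by
      rw [← Real.rpow_natCast 2 i, ← Real.rpow_add two_pos, ← Real.rpow_add two_pos,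
        ← Real.rpow_add two_pos, hqcast]
      ring_nf
    calc 4 * (4 * (2 : ℝ) ^ (κ * ρ + 2 * κ * q) * (b ^ (i - s) * Cb))
        = 16 * Cb * ((2 : ℝ) ^ (κ * ρ + 2 * κ * q) * b ^ (i - s)) := by ring
      _ = 16 * Cb * ((2 : ℝ) ^ (κ * ρ + 2 * κ * ((3 * ρ + 4 : ℕ) : ℝ)) * 2 ^ i *
            (2 : ℝ) ^ (-((1 - 2 * κ) * s))) := by rw [e1, e2]
      _ ≤ 16 * Cb * (2 ^ (4 * ρ + 4) * 2 ^ i * Z) := by gcongr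
      _ = 2 ^ i * 2 ^ (4 * ρ + 4) * (16 * Cb) * Z := by ring
  have hT3 : 4 * (η ^ 2 * 2 ^ ρ * 2 ^ (2 * q) * (1 / 2 : ℝ) ^ (i - s)) ≤
      2 ^ i * 2 ^ (7 * ρ + 8) * 32 * Z := by
    have e1 : (2 : ℝ) ^ (2 * q) * (1 / 2 : ℝ) ^ (i - s) = 2 ^ i * 2 ^ (6 * ρ + 8) * 2 ^ s := by
      have h3 : (2 : ℝ) ^ (i - s) ≠ 0 := by positivity
      rw [one_div_pow, mul_one_div, div_eq_iff h3, ← pow_add, ← pow_add, ← pow_add]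
      congr 1; omega
    calc 4 * (η ^ 2 * 2 ^ ρ * 2 ^ (2 * q) * (1 / 2 : ℝ) ^ (i - s))
        = 4 * 2 ^ ρ * ((2 : ℝ) ^ (2 * q) * (1 / 2 : ℝ) ^ (i - s)) * η ^ 2 := by ring
      _ = 4 * 2 ^ i * (2 ^ ρ * 2 ^ (6 * ρ + 8)) * (η ^ 2 * 2 ^ s) := by rw [e1]; ring
      _ = 4 * 2 ^ i * 2 ^ (7 * ρ + 8) * (η ^ 2 * 2 ^ s) := by rw [← pow_add]; ring_nf
      _ ≤ 4 * 2 ^ i * 2 ^ (7 * ρ + 8) * (8 * (2 : ℝ) ^ (-(c₀ * w))) := by gcongr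
      _ ≤ 4 * 2 ^ i * 2 ^ (7 * ρ + 8) * (8 * Z) := by gcongr
      _ = 2 ^ i * 2 ^ (7 * ρ + 8) * 32 * Z := by ring
  have hFR' : (2 : ℝ) ^ ρ * RB ≤ MN * lg * P11 * ((4 * Cκ₁ + 16 * Cb + 32) * Z) := by
    have h34 : (2 : ℝ) ^ (3 * ρ + 4) ≤ 2 ^ (7 * ρ + 8) := pow_le_pow_right₀ one_le_two (by omega)
    have h44 : (2 : ℝ) ^ (4 * ρ + 4) ≤ 2 ^ (7 * ρ + 8) := pow_le_pow_right₀ one_le_two (by omega)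
    have hbr : 4 * (2 : ℝ) ^ (κ * q) * ((2 : ℝ) ^ (κ * q) * Cκ₁) +
        4 * (4 * (2 : ℝ) ^ (κ * ρ + 2 * κ * q) * (b ^ (i - s) * Cb) +
          η ^ 2 * 2 ^ ρ * 2 ^ (2 * q) * (1 / 2 : ℝ) ^ (i - s)) ≤
        2 ^ i * 2 ^ (7 * ρ + 8) * (4 * Cκ₁ + 16 * Cb + 32) * Z := by
      have e : 4 * (4 * (2 : ℝ) ^ (κ * ρ + 2 * κ * q) * (b ^ (i - s) * Cb) +
          η ^ 2 * 2 ^ ρ * 2 ^ (2 * q) * (1 / 2 : ℝ) ^ (i - s)) =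
          4 * (4 * (2 : ℝ) ^ (κ * ρ + 2 * κ * q) * (b ^ (i - s) * Cb)) +
            4 * (η ^ 2 * 2 ^ ρ * 2 ^ (2 * q) * (1 / 2 : ℝ) ^ (i - s)) := by ring
      rw [e]
      have g1 : (2 : ℝ) ^ i * 2 ^ (3 * ρ + 4) * (4 * Cκ₁) * (2 : ℝ) ^ (-(c₀ * i)) ≤
          2 ^ i * 2 ^ (7 * ρ + 8) * (4 * Cκ₁) * Z := by gcongr
      have g2 : (2 : ℝ) ^ i * 2 ^ (4 * ρ + 4) * (16 * Cb) * Z ≤ 2 ^ i * 2 ^ (7 * ρ + 8) * (16 * Cb) * Z := by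
        gcongr
      linarith only [hT1, hT2, hT3, g1, g2]
    have e11 : (2 : ℝ) ^ ρ * (2 ^ j * 2 ^ (3 * ρ + 5)) * (2 ^ i * 2 ^ (7 * ρ + 8)) = MN * P11 := by
      rw [hMN, hP11, show 11 * ρ + 13 = ρ + (3 * ρ + 5) + (7 * ρ + 8) by ring, pow_add, pow_add]; ring
    calc (2 : ℝ) ^ ρ * RB = (2 : ℝ) ^ ρ * (2 ^ j * 2 ^ (3 * ρ + 5)) * lg *
          (4 * (2 : ℝ) ^ (κ * q) * ((2 : ℝ) ^ (κ * q) * Cκ₁) +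
            4 * (4 * (2 : ℝ) ^ (κ * ρ + 2 * κ * q) * (b ^ (i - s) * Cb) +
              η ^ 2 * 2 ^ ρ * 2 ^ (2 * q) * (1 / 2 : ℝ) ^ (i - s))) := by rw [hRB]; ring
      _ ≤ (2 : ℝ) ^ ρ * (2 ^ j * 2 ^ (3 * ρ + 5)) * lg *
          (2 ^ i * 2 ^ (7 * ρ + 8) * (4 * Cκ₁ + 16 * Cb + 32) * Z) :=
          mul_le_mul_of_nonneg_left hbr (by positivity)
      _ = (2 : ℝ) ^ ρ * (2 ^ j * 2 ^ (3 * ρ + 5)) * (2 ^ i * 2 ^ (7 * ρ + 8)) * lg *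
          ((4 * Cκ₁ + 16 * Cb + 32) * Z) := by ring
      _ = MN * lg * P11 * ((4 * Cκ₁ + 16 * Cb + 32) * Z) := by rw [e11]; ring
  -- total
  have hTOT : MN + 2 * 2 ^ ρ * (2 ^ i * ((2 ^ j / 2 ^ (ρ + (2 * ρ + 3)) + 2) * (2 ^ (ρ + 1) + 1))) +
      ((2 : ℝ) ^ ρ * (2 ^ j * η ^ 2 * (2 * 2 ^ ρ * 2 ^ i + 2 ^ q * lg)) +
        ∑ x ∈ Ico 1 (2 ^ ρ), ∑ r ∈ range q,
          ((2 : ℝ) ^ j + 2 ^ (q - r)) *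
            (lg * (2 * (2 : ℝ) ^ (κ * q) * (2 * (2 : ℝ) ^ (κ * ((q - r : ℕ) : ℝ)))) +
              2 * (min (η ^ 2 * 2 ^ (q - (r - x.factorization 2)) * 2 ^ (q - r))
                  (2 * (2 : ℝ) ^ (κ * ((q - (r - x.factorization 2) : ℕ) : ℝ)) *
                    (2 * (2 : ℝ) ^ (κ * ((q - r : ℕ) : ℝ)))) *
                (2 * ((2 : ℝ) ^ i / 2 ^ (q - r)) +
                  2 ^ (r - x.factorization 2) * (1 + Real.log ((2 : ℝ) ^ (r - x.factorization 2))))))) ≤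
      MN * (1 + (2 : ℝ) ^ (-(ρ : ℝ))) + MN * lg * P11 * (Cκ * Z) := by
    rw [hCκeq]
    have hsum := hFR.trans hFR'
    have e : MN * (1 + (2 : ℝ) ^ (-(ρ : ℝ))) + MN * lg * P11 * ((4 * Cκ₁ + 16 * Cb + 37) * Z) =
        MN + (MN * (2 : ℝ) ^ (-(ρ : ℝ)) + MN * lg * P11 * Z) + (MN * lg * P11 * (4 * Z) +
          MN * lg * P11 * ((4 * Cκ₁ + 16 * Cb + 32) * Z)) := by ring
    rw [e]
    exact add_le_add (add_le_add le_rfl hERR) (add_le_add hD hsum)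
  -- conclusion
  have hpre : (2 : ℝ) ^ i * (4 * 2 ^ j / 2 ^ ρ) = 4 * MN * (2 : ℝ) ^ (-(ρ : ℝ)) := by
    rw [hρneg, hMN]; field_simp
  have hfinal : 4 * MN * (2 : ℝ) ^ (-(ρ : ℝ)) * (MN * (1 + (2 : ℝ) ^ (-(ρ : ℝ))) + MN * lg * P11 * (Cκ * Z)) ≤
      MN ^ 2 * (8 * (2 : ℝ) ^ (-(ρ : ℝ)) + lg * Cκ * (2 : ℝ) ^ ((10 * ρ + 15 : ℕ) : ℝ) * Z) := by
    have e1 : 4 * (2 : ℝ) ^ (-(ρ : ℝ)) * P11 = (2 : ℝ) ^ ((10 * ρ + 15 : ℕ) : ℝ) := by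
      rw [hP11, show (4 : ℝ) = (2 : ℝ) ^ (2 : ℝ) by norm_num, ← Real.rpow_natCast 2 (11 * ρ + 13),
        ← Real.rpow_add two_pos, ← Real.rpow_add two_pos]
      congr 1; push_cast; ring
    have e2 : 4 * MN * (2 : ℝ) ^ (-(ρ : ℝ)) * (MN * (1 + (2 : ℝ) ^ (-(ρ : ℝ))) + MN * lg * P11 * (Cκ * Z)) =
        MN ^ 2 * (4 * (2 : ℝ) ^ (-(ρ : ℝ)) * (1 + (2 : ℝ) ^ (-(ρ : ℝ))) +
          lg * Cκ * (4 * (2 : ℝ) ^ (-(ρ : ℝ)) * P11) * Z) := by ring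
    rw [e2, e1]
    refine mul_le_mul_of_nonneg_left ?_ (by positivity)
    have : 4 * (2 : ℝ) ^ (-(ρ : ℝ)) * (1 + (2 : ℝ) ^ (-(ρ : ℝ))) ≤ 8 * (2 : ℝ) ^ (-(ρ : ℝ)) := by
      have h9 := mul_le_mul_of_nonneg_left hρneg1 hρneg0.le
      linarith only [h9]
    linarith only [this]
  calc (boxSum T i j ε β) ^ 2 ≤ _ := h
    _ ≤ (2 : ℝ) ^ i * (4 * 2 ^ j / 2 ^ ρ) *
        (MN * (1 + (2 : ℝ) ^ (-(ρ : ℝ))) + MN * lg * P11 * (Cκ * Z)) :=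
        mul_le_mul_of_nonneg_left hTOT (by positivity)
    _ = 4 * MN * (2 : ℝ) ^ (-(ρ : ℝ)) * (MN * (1 + (2 : ℝ) ^ (-(ρ : ℝ))) + MN * lg * P11 * (Cκ * Z)) := by
        rw [hpre]
    _ ≤ MN ^ 2 * (8 * (2 : ℝ) ^ (-(ρ : ℝ)) + lg * Cκ * (2 : ℝ) ^ ((10 * ρ + 15 : ℕ) : ℝ) * Z) := hfinal
    _ = _ := by rw [hMN]

/-- `√(a+b) ≤ √a + √b`. [folklore] -/
theorem sqrt_add_le_sqrt_add_sqrt'' {a b : ℝ} (ha : 0 ≤ a) (hb : 0 ≤ b) :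
    Real.sqrt (a + b) ≤ Real.sqrt a + Real.sqrt b := by
  rw [Real.sqrt_le_left (by positivity)]
  have h1 := Real.sq_sqrt ha
  have h2 := Real.sq_sqrt hb
  have h3 : 0 ≤ Real.sqrt a * Real.sqrt b := by positivity
  nlinarith

/-- `√(2^x) = 2^{x/2}`. [folklore] -/
theorem sqrt_two_rpow (x : ℝ) : Real.sqrt ((2 : ℝ) ^ x) = (2 : ℝ) ^ (x / 2) := by
  rw [Real.sqrt_eq_rpow, ← Real.rpow_mul (by norm_num)]; ring_nf

/-- `x ≤ 3^x` for `x ≥ 0`. [folklore] -/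
theorem le_three_rpow {x : ℝ} (hx : 0 ≤ x) : x ≤ (3 : ℝ) ^ x := by
  rw [Real.rpow_def_of_pos (by norm_num)]
  have h1 : 1 ≤ Real.log 3 := by
    have := Real.exp_one_lt_d9
    rw [Real.le_log_iff_exp_le (by norm_num)]
    linarith
  have h2 : x ≤ Real.log 3 * x := by nlinarith
  have h3 := Real.add_one_le_exp (Real.log 3 * x)
  linarith

set_option maxHeartbeats 800000 in
/-- **Bourgain 2013, §2, the type-II estimate for the unshifted window, clean form.** There are
constants `c > 0`, `C ≥ 1` (explicitly: `c = (1-2κ)c₂/2`, `C = C_κ + 8` with the `C_κ` of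
`boxSum_sq_le_clean_zero`) such that for every digit set `T`, every box `i ≤ j`, every
`1 ≤ ρ ≤ j` and every `|β| ≤ 1`,
`∑_{a ∈ D_i} |∑_{b ∈ D_j} β(b) w_T(ab)| ≤ (i+j+2)^C 2^{i+j} (2^{-cρ} + 2^{Cρ - ci} + 2^{Cρ - c|T ∩ [0,i)|})`
— the `K = 0` case of the per-box type-II hypothesis of
`LiouvilleWalsh.bourgain_liouville_walsh_uniform_of_typeII`.
[cite: Bourgain2013MoebiusWalsh, §2 (2.22), (2.28)–(2.29)] -/
theorem typeII_clean_zero :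
    ∃ c : ℝ, 0 < c ∧ ∃ C : ℝ, 1 ≤ C ∧
      ∀ (T : Finset ℕ) (i j ρ : ℕ) (β : ℕ → ℝ), i ≤ j → 1 ≤ ρ → ρ ≤ j → (∀ b, |β b| ≤ 1) →
        ∑ a ∈ dyBlock i, |∑ b ∈ dyBlock j, β b * natWalsh T (a * b)| ≤
          ((i : ℝ) + j + 2) ^ C * 2 ^ (i + j) *
            ((2 : ℝ) ^ (-(c * ρ)) + (2 : ℝ) ^ (C * ρ - c * i) +
              (2 : ℝ) ^ (C * ρ - c * ((T.filter fun t => 0 ≤ t ∧ t < 0 + i).card : ℝ))) := by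
  classical
  set κ : ℝ := walshL1Exponent with hκ
  set c₂ : ℝ := walshSupExponent with hc₂
  have hκ0 : 0 < κ := walshL1Exponent_pos
  have hκh : κ < 1 / 2 := walshL1Exponent_lt_half
  have hc₂0 : 0 < c₂ := walshSupExponent_pos
  have hc₂1 : c₂ ≤ 1 := walshSupExponent_le_one'
  set x₁ : ℝ := (2 : ℝ) ^ (-κ) with hx₁
  have hx₁1 : x₁ < 1 := Real.rpow_lt_one_of_one_lt_of_neg one_lt_two (by linarith)
  set b : ℝ := (2 : ℝ) ^ (1 - 2 * κ) with hb
  have hb1 : 1 < b := Real.one_lt_rpow one_lt_two (by linarith)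
  set Cκ : ℝ := 4 / (1 - x₁) + 16 * (b / (b - 1)) + 37 with hCκ
  have hCκ37 : 37 ≤ Cκ := by
    have h1 : 0 ≤ 4 / (1 - x₁) := div_nonneg (by norm_num) (by linarith)
    have h2 : 0 ≤ b / (b - 1) := div_nonneg (by linarith) (by linarith)
    rw [hCκ]; linarith
  set c₀ : ℝ := (1 - 2 * κ) * c₂ with hc₀
  have h12κ : 0 < 1 - 2 * κ := by linarith
  have hc₀0 : 0 < c₀ := mul_pos h12κ hc₂0
  have hc₀1 : c₀ ≤ 1 := by
    have := mul_le_mul (show 1 - 2 * κ ≤ 1 by linarith) hc₂1 hc₂0.le zero_le_one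
    linarith only [this]
  refine ⟨c₀ / 2, by positivity, Cκ + 8, by linarith, ?_⟩
  intro T i j ρ β hij hρ1 hρj hβ
  obtain ⟨ε, hε, hF⟩ := exists_sign_boxSum T i j β
  rw [hF]
  have hsq := boxSum_sq_le_clean_zero T hij hρj ε β hε hβ
  set q : ℕ := i + ρ + 1 + (2 * ρ + 3) with hq
  set w : ℕ := (T.filter fun x => 0 ≤ x ∧ x < i + ρ + 1 + (2 * ρ + 3)).card with hw
  set w₀ : ℕ := (T.filter fun t => 0 ≤ t ∧ t < 0 + i).card with hw₀
  set lg : ℝ := 1 + Real.log ((2 : ℝ) ^ q) with hlg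
  set MN : ℝ := (2 : ℝ) ^ i * 2 ^ j with hMN
  set C : ℝ := Cκ + 8 with hC
  set c : ℝ := c₀ / 2 with hc
  have hMN0 : 0 < MN := by positivity
  have hlg1 : 1 ≤ lg := by
    have := Real.log_nonneg (one_le_pow₀ (M₀ := ℝ) one_le_two (n := q)); rw [hlg]; linarith
  -- `F ≤ MN √Φ`
  set Φ : ℝ := 8 * (2 : ℝ) ^ (-(ρ : ℝ)) + lg * Cκ * (2 : ℝ) ^ ((10 * ρ + 15 : ℕ) : ℝ) *
    ((2 : ℝ) ^ (-(c₀ * i)) + (2 : ℝ) ^ (-(c₀ * w))) with hΦ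
  have hΦ0 : 0 ≤ Φ := by rw [hΦ]; positivity
  have hsq' : (boxSum T i j ε β) ^ 2 ≤ (MN * Real.sqrt Φ) ^ 2 := by
    rw [mul_pow, Real.sq_sqrt hΦ0]; exact hsq
  have hF0 : 0 ≤ boxSum T i j ε β := by rw [← hF]; positivity
  have hFle : boxSum T i j ε β ≤ MN * Real.sqrt Φ :=
    (pow_le_pow_iff_left₀ hF0 (by positivity) two_ne_zero).1 hsq'
  refine hFle.trans ?_
  -- `√Φ ≤ √8 2^{-ρ/2} + √(lg Cκ) 2^{(10ρ+15)/2} (2^{-c i} + 2^{-c w})`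
  have hsqrtΦ : Real.sqrt Φ ≤ 3 * (2 : ℝ) ^ (-(c * ρ)) +
      lg * Cκ * (2 : ℝ) ^ ((5 * ρ + 8 : ℕ) : ℝ) * ((2 : ℝ) ^ (-(c * i)) + (2 : ℝ) ^ (-(c * w))) := by
    have hA0 : 0 ≤ 8 * (2 : ℝ) ^ (-(ρ : ℝ)) := by positivity
    have hB0 : 0 ≤ lg * Cκ * (2 : ℝ) ^ ((10 * ρ + 15 : ℕ) : ℝ) *
        ((2 : ℝ) ^ (-(c₀ * i)) + (2 : ℝ) ^ (-(c₀ * w))) := by positivity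
    refine (sqrt_add_le_sqrt_add_sqrt'' hA0 hB0).trans (add_le_add ?_ ?_)
    · -- `√(8·2^{-ρ}) ≤ 3·2^{-cρ}`
      rw [Real.sqrt_mul (by norm_num), sqrt_two_rpow]
      have h8 : Real.sqrt 8 ≤ 3 := by
        rw [Real.sqrt_le_left (by norm_num)]; norm_num
      have hexp : (2 : ℝ) ^ (-(ρ : ℝ) / 2) ≤ (2 : ℝ) ^ (-(c * ρ)) := by
        refine Real.rpow_le_rpow_of_exponent_le one_le_two ?_
        have hρ0 : (0 : ℝ) ≤ ρ := Nat.cast_nonneg _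
        have : c * ρ ≤ (1 / 2) * ρ := mul_le_mul_of_nonneg_right (by rw [hc]; linarith) hρ0
        linarith only [this]
      exact mul_le_mul h8 hexp (by positivity) (by norm_num)
    · -- `√(lg Cκ 2^{10ρ+15} Z₀) ≤ lg Cκ 2^{5ρ+8} (2^{-ci} + 2^{-cw})`
      have hlC : 1 ≤ lg * Cκ := by nlinarith
      have hZ0 : 0 ≤ (2 : ℝ) ^ (-(c₀ * i)) + (2 : ℝ) ^ (-(c₀ * w)) := by positivity
      rw [Real.sqrt_mul (by positivity), Real.sqrt_mul (by positivity), sqrt_two_rpow]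
      have e1 : Real.sqrt (lg * Cκ) ≤ lg * Cκ := by
        rw [Real.sqrt_le_left (by positivity)]; nlinarith
      have e2 : (2 : ℝ) ^ (((10 * ρ + 15 : ℕ) : ℝ) / 2) ≤ (2 : ℝ) ^ ((5 * ρ + 8 : ℕ) : ℝ) := by
        refine Real.rpow_le_rpow_of_exponent_le one_le_two ?_
        push_cast; linarith
      have e3 : Real.sqrt ((2 : ℝ) ^ (-(c₀ * i)) + (2 : ℝ) ^ (-(c₀ * w))) ≤
          (2 : ℝ) ^ (-(c * i)) + (2 : ℝ) ^ (-(c * w)) := by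
        refine (sqrt_add_le_sqrt_add_sqrt'' (by positivity) (by positivity)).trans ?_
        rw [sqrt_two_rpow, sqrt_two_rpow]
        refine add_le_add (le_of_eq ?_) (le_of_eq ?_) <;> (congr 1; rw [hc]; ring)
      exact mul_le_mul (mul_le_mul e1 e2 (by positivity) (by positivity)) e3 (by positivity)
        (by positivity)
  -- sizes of `lg` and the prefactors
  have hbase3 : (3 : ℝ) ≤ (i : ℝ) + j + 2 := by
    have : (1 : ℝ) ≤ j := by exact_mod_cast (hρ1.trans hρj)
    have : (0 : ℝ) ≤ i := Nat.cast_nonneg _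
    linarith
  have hbase1 : (1 : ℝ) ≤ (i : ℝ) + j + 2 := by linarith
  have hC1 : 1 ≤ C := by rw [hC]; linarith
  have hC0 : 0 ≤ C := by linarith
  have hpowC : ((i : ℝ) + j + 2) ^ C = ((i : ℝ) + j + 2) * ((i : ℝ) + j + 2) ^ (C - 1) := by
    conv_lhs => rw [show C = 1 + (C - 1) by ring]
    rw [Real.rpow_add (by linarith), Real.rpow_one]
  have hpowC1 : (3 : ℝ) ^ (C - 1) ≤ ((i : ℝ) + j + 2) ^ (C - 1) :=
    Real.rpow_le_rpow (by norm_num) hbase3 (by linarith)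
  have h3C : (1 : ℝ) ≤ (3 : ℝ) ^ (C - 1) := Real.one_le_rpow (by norm_num) (by linarith)
  -- (i) `3 · 2^{-cρ} ≤ (i+j+2)^C 2^{-cρ}`
  have hI : 3 * (2 : ℝ) ^ (-(c * ρ)) ≤ ((i : ℝ) + j + 2) ^ C * (2 : ℝ) ^ (-(c * ρ)) := by
    refine mul_le_mul_of_nonneg_right ?_ (by positivity)
    rw [hpowC]
    have := mul_le_mul hbase3 (h3C.trans hpowC1) zero_le_one (by positivity)
    linarith
  -- (ii) `lg Cκ 2^{5ρ+8} ≤ (i+j+2)^C 2^{Cρ}`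
  have hlg_le : lg ≤ ((i : ℝ) + j + 2) * 2 ^ (ρ + 2) := by
    have h1 : lg ≤ (q : ℝ) + 1 := by
      rw [hlg, Real.log_pow]
      have h2 : Real.log 2 ≤ 1 := by have := Real.log_two_lt_d9; linarith
      have : (q : ℝ) * Real.log 2 ≤ q := by
        have := mul_le_mul_of_nonneg_left h2 (Nat.cast_nonneg q); simpa using this
      linarith
    have h2 : ((q : ℝ) + 1) = ((i : ℝ) + j + 2) + ((3 * ρ + 3 : ℕ) : ℝ) - j := by
      rw [hq]; push_cast; ring
    have h3 : ((3 * ρ + 4 : ℕ) : ℝ) ≤ (2 : ℝ) ^ (ρ + 2) := by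
      have : 3 * ρ + 4 ≤ 2 ^ (ρ + 2) := by
        have := Nat.lt_two_pow_self (n := ρ)
        rw [pow_add]; omega
      exact_mod_cast this
    have h4 : (q : ℝ) + 1 ≤ ((i : ℝ) + j + 2) * ((3 * ρ + 4 : ℕ) : ℝ) := by
      have hj0 : (0 : ℝ) ≤ j := Nat.cast_nonneg _
      have : ((3 * ρ + 3 : ℕ) : ℝ) + 1 = ((3 * ρ + 4 : ℕ) : ℝ) := by push_cast; ring
      have h34 : (1 : ℝ) ≤ ((3 * ρ + 3 : ℕ) : ℝ) := by
        have : 1 ≤ 3 * ρ + 3 := by omega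
        exact_mod_cast this
      -- `a + b ≤ a (b + 1)` for `a ≥ 1`
      nlinarith
    calc lg ≤ (q : ℝ) + 1 := h1
      _ ≤ ((i : ℝ) + j + 2) * ((3 * ρ + 4 : ℕ) : ℝ) := h4
      _ ≤ ((i : ℝ) + j + 2) * 2 ^ (ρ + 2) := mul_le_mul_of_nonneg_left h3 (by linarith)
  have hII : lg * Cκ * (2 : ℝ) ^ ((5 * ρ + 8 : ℕ) : ℝ) ≤ ((i : ℝ) + j + 2) ^ C * (2 : ℝ) ^ (C * ρ) := by
    -- `Cκ ≤ 3^{C-1}` and `2^{ρ+2} 2^{5ρ+8} ≤ 2^{Cρ}`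
    have hCκ3 : Cκ ≤ (3 : ℝ) ^ (C - 1) := by
      have h1 : Cκ ≤ (3 : ℝ) ^ Cκ := le_three_rpow (by linarith)
      have h2 : (3 : ℝ) ^ Cκ ≤ (3 : ℝ) ^ (C - 1) :=
        Real.rpow_le_rpow_of_exponent_le (by norm_num) (by rw [hC]; linarith)
      linarith
    have hexp : (2 : ℝ) ^ (ρ + 2) * (2 : ℝ) ^ ((5 * ρ + 8 : ℕ) : ℝ) ≤ (2 : ℝ) ^ (C * ρ) := by
      rw [← Real.rpow_natCast 2 (ρ + 2), ← Real.rpow_add two_pos]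
      refine Real.rpow_le_rpow_of_exponent_le one_le_two ?_
      push_cast
      have hρ1' : (1 : ℝ) ≤ ρ := by exact_mod_cast hρ1
      have : (45 : ℝ) ≤ C := by rw [hC]; linarith
      nlinarith
    calc lg * Cκ * (2 : ℝ) ^ ((5 * ρ + 8 : ℕ) : ℝ)
        ≤ (((i : ℝ) + j + 2) * 2 ^ (ρ + 2)) * (3 : ℝ) ^ (C - 1) * (2 : ℝ) ^ ((5 * ρ + 8 : ℕ) : ℝ) := by
          gcongr
      _ = ((i : ℝ) + j + 2) * (3 : ℝ) ^ (C - 1) * ((2 : ℝ) ^ (ρ + 2) * (2 : ℝ) ^ ((5 * ρ + 8 : ℕ) : ℝ)) := by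
          ring
      _ ≤ ((i : ℝ) + j + 2) * ((i : ℝ) + j + 2) ^ (C - 1) * (2 : ℝ) ^ (C * ρ) := by gcongr
      _ = ((i : ℝ) + j + 2) ^ C * (2 : ℝ) ^ (C * ρ) := by rw [hpowC]
  -- the window `w ≥ w₀`
  have hww₀ : w₀ ≤ w := by
    rw [hw, hw₀]
    refine Finset.card_le_card fun t ht => ?_
    simp only [Finset.mem_filter] at ht ⊢
    exact ⟨ht.1, ht.2.1, by omega⟩
  have hexpw : (2 : ℝ) ^ (-(c * w)) ≤ (2 : ℝ) ^ (-(c * w₀)) := by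
    refine Real.rpow_le_rpow_of_exponent_le one_le_two ?_
    have : (w₀ : ℝ) ≤ w := by exact_mod_cast hww₀
    have hc0 : 0 ≤ c := by positivity
    have := mul_le_mul_of_nonneg_left this hc0
    linarith
  -- assemble
  have hpos1 : 0 ≤ (2 : ℝ) ^ (-(c * i)) + (2 : ℝ) ^ (-(c * w)) := by positivity
  have eC1 : (2 : ℝ) ^ (C * ρ) * (2 : ℝ) ^ (-(c * i)) = (2 : ℝ) ^ (C * ρ - c * i) := by
    rw [← Real.rpow_add two_pos]; ring_nf
  have eC2 : (2 : ℝ) ^ (C * ρ) * (2 : ℝ) ^ (-(c * w₀)) = (2 : ℝ) ^ (C * ρ - c * w₀) := by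
    rw [← Real.rpow_add two_pos]; ring_nf
  have hMNeq : MN = 2 ^ (i + j) := by rw [hMN, pow_add]
  calc MN * Real.sqrt Φ ≤ MN * (3 * (2 : ℝ) ^ (-(c * ρ)) +
        lg * Cκ * (2 : ℝ) ^ ((5 * ρ + 8 : ℕ) : ℝ) * ((2 : ℝ) ^ (-(c * i)) + (2 : ℝ) ^ (-(c * w)))) :=
        mul_le_mul_of_nonneg_left hsqrtΦ hMN0.le
    _ ≤ MN * (((i : ℝ) + j + 2) ^ C * (2 : ℝ) ^ (-(c * ρ)) +
        ((i : ℝ) + j + 2) ^ C * (2 : ℝ) ^ (C * ρ) * ((2 : ℝ) ^ (-(c * i)) + (2 : ℝ) ^ (-(c * w₀)))) := by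
        refine mul_le_mul_of_nonneg_left (add_le_add hI ?_) hMN0.le
        exact mul_le_mul hII (by linarith) hpos1 (by positivity)
    _ = ((i : ℝ) + j + 2) ^ C * 2 ^ (i + j) *
        ((2 : ℝ) ^ (-(c * ρ)) + (2 : ℝ) ^ (C * ρ - c * i) + (2 : ℝ) ^ (C * ρ - c * w₀)) := by
        rw [← eC1, ← eC2, hMNeq]; ring

end Literature.NumberTheory.LFunctions.LiouvilleWalsh

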